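import Mathlib
import HarnessLib
import Summits.NavierStokesRegularity.NavierStokesRegularity.Theses.PoloidalWindowDoor
import Summits.NavierStokesRegularity.NavierStokesRegularity.Theorems.PoloidalWindowDoorPoloidalWindowRigiditySharper
import Summits.NavierStokesRegularity.NavierStokesRegularity.Theorems.PoloidalWindowDoorPoloidalWindowRigidityK2OfLrcSpatial
import Summits.NavierStokesRegularity.NavierStokesRegularity.Theorems.PoloidalWindowDoorPoloidalWindowRigidityHorizontalFlatPast
import Summits.NavierStokesRegularity.NavierStokesRegularity.Theorems.PoloidalWindowDoorPoloidalWindowRigidityEntireGerm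
import Summits.NavierStokesRegularity.NavierStokesRegularity.Theorems.PoloidalWindowDoorPoloidalWindowRigidityTimeShearLiminf
import Summits.NavierStokesRegularity.NavierStokesRegularity.Theorems.PoloidalWindowDoorPoloidalWindowRigidityK2OfLrcSlope
import Summits.NavierStokesRegularity.NavierStokesRegularity.Theorems.PoloidalWindowDoorPoloidalWindowRigidityStubUntwisted
import Summits.NavierStokesRegularity.NavierStokesRegularity.Theorems.PoloidalWindowDoorPoloidalWindowRigidityThmASemiEllipticThick
import Summits.NavierStokesRegularity.NavierStokesRegularity.Theorems.PoloidalWindowDoorPoloidalWindowRigidityThickStubsOfLocalEmpty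

/-!
# SKELETON `mixed_type` (v2) — crux `PoloidalWindowRigidity` (K2, stmt-NavierStokesRegularity-19708), route `PoloidalWindowDoor`
# (crux-strategist seat cstrat-stmt-NavierStokesRegularity-19708-g0, 2026-08-27; runs ALONGSIDE the registered line `lrc_jet` v5,
# whose one open stub `stub_twisting` it re-cuts; nothing of the lead's files is touched)

THE CUT.  On a non-degenerate window the poloidal frozen kinematics of a class profile is the single divergence-form identity
`div(∂₂v) = 0`, i.e. `∂₂²v₂ + divₕ(∂₂vₕ) = 0` with `∂₂vₕ = Λ ∇ₕv₂` (shear ratio `Λ = 1 − 1/σ`, `σ` the Clebsch slope): an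
equation for `w = v₂` with symbol `diag(Λ, Λ, 1)` whose TYPE is the sign of the scalar
`I := ⟪∂₂vₕ, ∇ₕv₂⟫ = ∂₂v₀·∂₀v₂ + ∂₂v₁·∂₁v₂ = Λ|∇ₕv₂|²` — ELLIPTIC where `I > 0`, HYPERBOLIC WITH THE HEIGHT `x₂` AS TIME where
`I < 0` (`∂₂²w = divₕ(|Λ|∇ₕw)`, a quasilinear wave equation, genuinely non-linear in Lax's sense exactly on the THICK stratum
`∂_wΛ ≠ 0`, linearly degenerate exactly on (TH)).  The tree's M11 (`…EllipticSlope`, `…DivForm*`: De Giorgi–Nash–Moser) settles the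
UNIFORMLY elliptic slices `Λ ∈ [μ₀, μ₁]`, `μ₀ > 0`; every (M)-free witness and the one exact twisting NS family in the tree
(`…Negative.CrossedSuctionLayers`, `Λ ≡ −1`) is hyperbolic.  This skeleton makes the type dichotomy a KERNEL THEOREM inside
`stub_twisting`, using the freedom that analyticity gives to RELOCATE the twisting window:

* either some slice `s` in the time-range of the window carries a HYPERBOLIC point (`I(s,y) < 0`): then — `I < 0` being open
  in space–time (joint continuity of the Jacobian entries, `…K2OfLrcSlope`), the twist bracket `T(s,·)` being a real-analytic
  function on `ℝ³` not identically zero (it is `≠ 0` on the window), and `I < 0` forcing non-degeneracy pointwise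
  (`nd_of_inner_neg`: `curl v = 0` would give `I = |∇ₕv₂|² ≥ 0`) — there is a nonempty open HYPERBOLIC TWISTING window
  `W' = {I < 0} ∩ {T ≠ 0}` in the same time-slab, and it inherits the (TV)-pin from the original window by the identity
  theorem on each slice (`∂₂v_b − m(t)∂_bv₂` is real-analytic in `y` on `ℝ³`; vanishing on a ball it vanishes on the original
  window's box — `twisting_of_mixedType`); `W'` is then cut, as in K2-p3's `twist_split` v3 of item 20428, into its (TH) part
  (`stub_hyperbolicTH`) and its thick part (`stub_hyperbolicThick`) — `hyperbolic_of_stubs`;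
* or EVERY slice of the slab is SEMI-ELLIPTIC (`I ≥ 0` at every point): `stub_semiElliptic` — the one-sided extension of M11
  («EllipticSlope without the two-sided bound»: the ellipticity ratio may degenerate, `inf Λ = 0` or `sup Λ = ∞`, the latter
  exactly at horizontal critical points of `v₂` that are not critical for `∂₂vₕ`).

THREE REGISTERED STUBS, each VERBATIM `stub_twisting` plus extra hypotheses (so each is strictly smaller), each consuming (M)
(the disproof class `…Negative.*FalseWithoutMild` is honoured: no stub survives deletion of the Oseen identity, exactly as for
`stub_twisting`), each with its own tool-set (line card `Lines/mixed_type.md`):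
* `stub_semiElliptic` — degenerate-elliptic Liouville for `div(diag(Λ,Λ,1)∇w) = 0`, `Λ ≥ 0` real-analytic and LEAFWISE
  (`Λ = Λ(w, x₂)`), on a slab of slices; dynamic handle: on a semi-elliptic slice the pressure is SUPERHARMONIC with
  `−Δp ≥ |∇ₕvₕ|² + (∂₂v₂)²` (`…PressureRegime`), whence `|B_R|⁻¹∫_{B_R}(|∇ₕvₕ|² + (∂₂v₂)²) ≤ C R⁻¹(−t)^{-3/2}` — horizontal
  gradients are sparse at large scales on every slice of the slab.
* `stub_hyperbolicTH` — (TH) ∩ hyperbolic ∩ twisting: the linear wave structure `∂₂²w = |μ(t,x₂)| Δₕw` on the window; shared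
  with the exact-elimination lane of `Cruxes/LrcModEntire/Lines/twist_split.lean::stub_twistingTH` (K2-p3 g7 / nsreg-p7 / cert-1):
  a proof of that stub in the currency `v ≡ 0`/`¬ singular` closes this one.
* `stub_hyperbolicThick` — thick ∩ hyperbolic ∩ twisting: the research residue, now typed as a GENUINELY NON-LINEAR wave
  equation in the height for an entire (all heights, both directions) bounded analytic solution — the regime of Lax/John
  shock formation (Riccati blow-up of second derivatives along bicharacteristics unless the compression vanishes), plus the
  class dynamics.

COMPOSITION (all proved, no sorry outside the three stubs): `hyperbolic_of_stubs` ((TH)/thick dichotomy on a hyperbolic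
window) → `twisting_of_mixedType` (= the statement of `lrc_jet`'s `stub_twisting`, by the relocation argument above) →
`ndRegular` → `lrcSpatial_of_stubs` → `sliceSharpNonflatLiouville_of_mixedType` → `PoloidalWindowRigidity_of_mixedType :
PoloidalWindowRigidity` (the last four exactly as in `lrc_jet` v5, with the tree theorem `…StubUntwisted.stub_untwisted`
(p561151) for the untwisted half and the tree's (TV) theorems).

v2 (cstrat g2, 2026-08-27, after ns-poloidal-K2-p2 g6's THEOREM A — `…ThmAClass.not_timeHeightShear_semiElliptic`, p579231;
`…ThmASemiEllipticThick.semiElliptic_regular_of_thick`, p580444; `…ThmARelocation.twistingTH_regular_of_hyperbolicTH`, p580224):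
the semi-elliptic (TH) case is CLOSED in the class (a bounded slice solving the linear semi-elliptic slice equation
`∂₂²v₂ + μ(t,x₂)Δₕv₂ = 0`, `μ ≥ 0`, is horizontally constant — weighted convexity of the frequency-localised `L²` along the
height), so `stub_semiElliptic` is now a THEOREM of this file, proved from the NEW registered stub `stub_semiEllipticThick`
(:= `stub_semiElliptic` VERBATIM + the thickness clause of `stub_hyperbolicThick`; K2-p2's suggested re-cut).  The registered
stubs of v2 are `{stub_hyperbolicTH, stub_hyperbolicThick, stub_semiEllipticThick}`: (TH) survives ONLY in hyperbolic dress, and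
both THICK stubs close BY NAME from ONE velocity-only local certificate `hempty_thick` (K2-p5 p579093 / K2-p4 p580261:
`stub_hyperbolicThick_of_localEmptyThick`; here `stub_semiEllipticThick_of_localEmptyThick`, proved), the (TH) stub from the
local certificate `hempty` (K2-p3 p573297 `…HyperbolicTHOfLocalEmpty.stub_hyperbolicTH_of_localEmpty`, tree).  So the SAME two
certificates that close `lrc_jet`/`twist_split`/`local_rigidity` close this line by name; what this line adds is the TYPE
information each certificate may assume (hyperbolic sign for `hempty`: wave equation in the height, K2-p2's `hempty_hyp`; no
sign needed for `hempty_thick`).  The GLOBAL contingency (cert-1 verdict PASSIVE: local germs exist, the certificates are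
false as local statements) is NOT covered by any registered line; see `STRATEGY-CENSUS.md` (cstrat g2) in the crux directory.

WHAT THIS IS NOT: not a proof of K2, not a claim about Navier–Stokes regularity (nothing about Clay (A) is proved here) — a
registered re-partition of the twisting residue by the type of the kinematic equation, with one kernel-checked relocation lemma.
-/

-- the summit and its single sub-problem share the name (CONVENTIONS §1)
set_option linter.dupNamespace false

namespace Summit.NavierStokesRegularity.NavierStokesRegularity.Cruxes.PoloidalWindowRigidity.MixedType

open Set Function Metric
open scoped RealInnerProductSpace InnerProductSpace Topology
open Literature.Analysis Literature.Analysis.FluidPDE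
open Summit.NavierStokesRegularity.NavierStokesRegularity.Theorems.PoloidalWindowDoorPoloidalWindowRigiditySharper
open Summit.NavierStokesRegularity.NavierStokesRegularity.Theorems.PoloidalWindowDoorPoloidalWindowRigidityK2OfLrcSpatial
open Summit.NavierStokesRegularity.NavierStokesRegularity.Theorems.PoloidalWindowDoorPoloidalWindowRigidityHorizontalFlatPast
open Summit.NavierStokesRegularity.NavierStokesRegularity.Theorems.PoloidalWindowDoorPoloidalWindowRigidityK2OfLrcSlope
open Summit.NavierStokesRegularity.NavierStokesRegularity.Theorems.TubeAlternative.AnalyticPropagation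

/-! ### The three registered stubs -/

/-- **STUB (E-THICK, v2): NON-DEGENERATE + PIN + TWISTING + THICK window inside a SLAB OF SEMI-ELLIPTIC SLICES ⇒ regular.**
(v2: the extra LAST hypothesis is the thickness clause of `stub_hyperbolicThick` — the shear ratio is a function of `(t, x₂)` on NO
nonempty open sub-window; the (TH) part of v1's stub is Theorem A.  Closes BY NAME from the local certificate `hempty_thick`:
`stub_semiEllipticThick_of_localEmptyThick` below.)  Verbatim the
hypotheses of `lrc_jet`'s `stub_twisting` (class, poloidal, a nonempty open non-degenerate window `W` with the (TV)-pin and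
non-zero twist bracket), PLUS: `W` lies in a time-slab `(a,b) × ℝ³` every slice of which is SEMI-ELLIPTIC —
`⟪∂₂vₕ, ∇ₕv₂⟫ = ∂₂v₀·∂₀v₂ + ∂₂v₁·∂₁v₂ ≥ 0` at EVERY point (the kinematic identity `∂₂²v₂ + divₕ(∂₂vₕ) = 0` has non-negative
type everywhere; no hyperbolic point).  The uniformly elliptic sub-case (shear ratio in `[μ₀, μ₁]`, `μ₀ > 0`, on one slice) is the
tree theorem `…EllipticSlopeUnconditional` (M11, De Giorgi–Nash–Moser); what remains is the DEGENERATING ratio (`inf = 0`, or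
`sup = ∞` at horizontal critical points of `v₂` with `∂₂vₕ ≠ 0`).  Handles: weighted (Fabes–Kenig–Serapioni) DGNM for the
leafwise analytic weight; superharmonic pressure `−Δp ≥ |∇ₕvₕ|² + (∂₂v₂)²` on every slice of the slab (`…PressureRegime`) ⇒
large-scale sparsity of `∇ₕvₕ`; the class dynamics (M12 variance law has the good production sign wherever `Λ ≤ 1`). -/
theorem stub_semiEllipticThick :
    ∀ (C : ℝ) (v : ℝ → EuclideanSpace ℝ (Fin 3) → EuclideanSpace ℝ (Fin 3)),
      Literature.Analysis.FluidPDE.HasTypeITimeDecay C v →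
      ContinuousOn (Function.uncurry v) (Set.Iio (0 : ℝ) ×ˢ Set.univ) →
      (∀ s t : ℝ, s < t → t < 0 → ∀ x, v t x =
        Literature.Analysis.UnboundedOperators.heatExtension (v s) (t - s) x -
          Literature.Analysis.FluidPDE.oseenDuhamel 1 s v v t x) →
      (∀ t < 0, Literature.Analysis.FluidPDE.VectorCalculus.IsDivFree (v t)) →
      (∀ s < 0, ∀ y, ⟪Literature.Analysis.FluidPDE.curl (v s) y, EuclideanSpace.single 2 1⟫_ℝ = 0) →
      ∀ W : Set (ℝ × EuclideanSpace ℝ (Fin 3)), IsOpen W → W.Nonempty → W ⊆ Set.Iio (0 : ℝ) ×ˢ Set.univ →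
        (∀ z ∈ W, Literature.Analysis.FluidPDE.curl (v z.1) z.2 ≠ 0 ∧
          (fderiv ℝ (v z.1) z.2 (EuclideanSpace.single 0 1) 2 ≠ 0 ∨ fderiv ℝ (v z.1) z.2 (EuclideanSpace.single 1 1) 2 ≠ 0) ∧
          (fderiv ℝ (v z.1) z.2 (EuclideanSpace.single 2 1) 0 ≠ 0 ∨ fderiv ℝ (v z.1) z.2 (EuclideanSpace.single 2 1) 1 ≠ 0)) →
        (∀ m : ℝ → ℝ, ∀ W₁ : Set (ℝ × EuclideanSpace ℝ (Fin 3)), W₁ ⊆ W → IsOpen W₁ → W₁.Nonempty →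
          ∃ z ∈ W₁, ∃ b : Fin 3, b ≠ 2 ∧
            fderiv ℝ (v z.1) z.2 (EuclideanSpace.single 2 1) b ≠
              m z.1 * fderiv ℝ (v z.1) z.2 (EuclideanSpace.single b 1) 2) →
        (∀ z ∈ W,
          fderiv ℝ (fun x => fderiv ℝ (v z.1) x (EuclideanSpace.single 2 1) 2) z.2 (EuclideanSpace.single 0 1) *
              fderiv ℝ (v z.1) z.2 (EuclideanSpace.single 1 1) 2 -
            fderiv ℝ (fun x => fderiv ℝ (v z.1) x (EuclideanSpace.single 2 1) 2) z.2 (EuclideanSpace.single 1 1) *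
              fderiv ℝ (v z.1) z.2 (EuclideanSpace.single 0 1) 2 ≠ 0) →
        ∀ a b : ℝ, W ⊆ Set.Ioo a b ×ˢ Set.univ →
          (∀ s ∈ Set.Ioo a b, ∀ y : EuclideanSpace ℝ (Fin 3),
            0 ≤ fderiv ℝ (v s) y (EuclideanSpace.single 2 1) 0 * fderiv ℝ (v s) y (EuclideanSpace.single 0 1) 2 +
              fderiv ℝ (v s) y (EuclideanSpace.single 2 1) 1 * fderiv ℝ (v s) y (EuclideanSpace.single 1 1) 2) →
        (∀ m : ℝ → ℝ → ℝ, ∀ W₁ : Set (ℝ × EuclideanSpace ℝ (Fin 3)), W₁ ⊆ W → IsOpen W₁ → W₁.Nonempty →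
          ∃ z ∈ W₁, ∃ b : Fin 3, b ≠ 2 ∧
            fderiv ℝ (v z.1) z.2 (EuclideanSpace.single 2 1) b ≠
              m z.1 (z.2 2) * fderiv ℝ (v z.1) z.2 (EuclideanSpace.single b 1) 2) →
        ¬ Literature.Analysis.FluidPDE.IsBackwardSingularPoint v 0 := by
  sorry

/-- **(former STUB (E), now a THEOREM of v2) SEMI-ELLIPTIC SLAB ⇒ regular**, from `stub_semiEllipticThick` by K2-p2 g6's
`…ThmASemiEllipticThick.semiElliptic_regular_of_thick` (Theorem A, class form: a (TH) sub-window inside a semi-elliptic slab is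
impossible, so every such window is thick).  Statement VERBATIM v1's `stub_semiElliptic`. -/
theorem stub_semiElliptic :
    ∀ (C : ℝ) (v : ℝ → EuclideanSpace ℝ (Fin 3) → EuclideanSpace ℝ (Fin 3)),
      Literature.Analysis.FluidPDE.HasTypeITimeDecay C v →
      ContinuousOn (Function.uncurry v) (Set.Iio (0 : ℝ) ×ˢ Set.univ) →
      (∀ s t : ℝ, s < t → t < 0 → ∀ x, v t x =
        Literature.Analysis.UnboundedOperators.heatExtension (v s) (t - s) x -
          Literature.Analysis.FluidPDE.oseenDuhamel 1 s v v t x) →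
      (∀ t < 0, Literature.Analysis.FluidPDE.VectorCalculus.IsDivFree (v t)) →
      (∀ s < 0, ∀ y, ⟪Literature.Analysis.FluidPDE.curl (v s) y, EuclideanSpace.single 2 1⟫_ℝ = 0) →
      ∀ W : Set (ℝ × EuclideanSpace ℝ (Fin 3)), IsOpen W → W.Nonempty → W ⊆ Set.Iio (0 : ℝ) ×ˢ Set.univ →
        (∀ z ∈ W, Literature.Analysis.FluidPDE.curl (v z.1) z.2 ≠ 0 ∧
          (fderiv ℝ (v z.1) z.2 (EuclideanSpace.single 0 1) 2 ≠ 0 ∨ fderiv ℝ (v z.1) z.2 (EuclideanSpace.single 1 1) 2 ≠ 0) ∧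
          (fderiv ℝ (v z.1) z.2 (EuclideanSpace.single 2 1) 0 ≠ 0 ∨ fderiv ℝ (v z.1) z.2 (EuclideanSpace.single 2 1) 1 ≠ 0)) →
        (∀ m : ℝ → ℝ, ∀ W₁ : Set (ℝ × EuclideanSpace ℝ (Fin 3)), W₁ ⊆ W → IsOpen W₁ → W₁.Nonempty →
          ∃ z ∈ W₁, ∃ b : Fin 3, b ≠ 2 ∧
            fderiv ℝ (v z.1) z.2 (EuclideanSpace.single 2 1) b ≠
              m z.1 * fderiv ℝ (v z.1) z.2 (EuclideanSpace.single b 1) 2) →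
        (∀ z ∈ W,
          fderiv ℝ (fun x => fderiv ℝ (v z.1) x (EuclideanSpace.single 2 1) 2) z.2 (EuclideanSpace.single 0 1) *
              fderiv ℝ (v z.1) z.2 (EuclideanSpace.single 1 1) 2 -
            fderiv ℝ (fun x => fderiv ℝ (v z.1) x (EuclideanSpace.single 2 1) 2) z.2 (EuclideanSpace.single 1 1) *
              fderiv ℝ (v z.1) z.2 (EuclideanSpace.single 0 1) 2 ≠ 0) →
        ∀ a b : ℝ, W ⊆ Set.Ioo a b ×ˢ Set.univ →
          (∀ s ∈ Set.Ioo a b, ∀ y : EuclideanSpace ℝ (Fin 3),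
            0 ≤ fderiv ℝ (v s) y (EuclideanSpace.single 2 1) 0 * fderiv ℝ (v s) y (EuclideanSpace.single 0 1) 2 +
              fderiv ℝ (v s) y (EuclideanSpace.single 2 1) 1 * fderiv ℝ (v s) y (EuclideanSpace.single 1 1) 2) →
        ¬ Literature.Analysis.FluidPDE.IsBackwardSingularPoint v 0 := by
  intro C v hrate hcont hmild hdiv hpol W hW hWne hWs hnd hpin htw a b hWab hsemi
  exact Summit.NavierStokesRegularity.NavierStokesRegularity.Theorems.PoloidalWindowDoorPoloidalWindowRigidityThmASemiEllipticThick.semiElliptic_regular_of_thick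
    C v hrate hcont hmild hdiv
    (fun W' hW' hW'ne hW's hnd' hpin' htw' a' b' hWab' hsemi' hth' =>
      stub_semiEllipticThick C v hrate hcont hmild hdiv hpol W' hW' hW'ne hW's hnd' hpin' htw' a' b' hWab' hsemi' hth')
    W hW hWne hWs hnd hpin htw a b hWab hsemi

/-- **STUB (H-TH): NON-DEGENERATE + PIN + TWISTING + HYPERBOLIC window ON THE TIME–HEIGHT STRATUM ⇒ regular.**  Verbatim the
hypotheses of `stub_twisting`, PLUS: the window is HYPERBOLIC pointwise (`∂₂v₀·∂₀v₂ + ∂₂v₁·∂₁v₂ < 0`: shear ratio `Λ < 0`,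
Clebsch slope in `(0,1)`; the kinematic identity is the wave equation `∂₂²v₂ = divₕ(|Λ|∇ₕv₂)` with the height as time) AND the
shear ratio is a function of time and height on the window (`∂₂v_b(s,y) = m(s, y₂)·∂_bv₂(s,y)`, `b = 0,1`: the stratum (TH), on
which the wave equation is LINEAR, `∂₂²v₂ = |m(t,x₂)|Δₕv₂`, tree `…TimeHeightShearLinearSlice`).  Shared with the exact-elimination
lane of `Cruxes/LrcModEntire/Lines/twist_split.lean::stub_twistingTH` (hyperbolic sub-case): a landing of that stub in the currency
`¬ IsBackwardSingularPoint` / `v ≡ 0` closes this one verbatim. -/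
theorem stub_hyperbolicTH :
    ∀ (C : ℝ) (v : ℝ → EuclideanSpace ℝ (Fin 3) → EuclideanSpace ℝ (Fin 3)),
      Literature.Analysis.FluidPDE.HasTypeITimeDecay C v →
      ContinuousOn (Function.uncurry v) (Set.Iio (0 : ℝ) ×ˢ Set.univ) →
      (∀ s t : ℝ, s < t → t < 0 → ∀ x, v t x =
        Literature.Analysis.UnboundedOperators.heatExtension (v s) (t - s) x -
          Literature.Analysis.FluidPDE.oseenDuhamel 1 s v v t x) →
      (∀ t < 0, Literature.Analysis.FluidPDE.VectorCalculus.IsDivFree (v t)) →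
      (∀ s < 0, ∀ y, ⟪Literature.Analysis.FluidPDE.curl (v s) y, EuclideanSpace.single 2 1⟫_ℝ = 0) →
      ∀ W : Set (ℝ × EuclideanSpace ℝ (Fin 3)), IsOpen W → W.Nonempty → W ⊆ Set.Iio (0 : ℝ) ×ˢ Set.univ →
        (∀ z ∈ W, Literature.Analysis.FluidPDE.curl (v z.1) z.2 ≠ 0 ∧
          (fderiv ℝ (v z.1) z.2 (EuclideanSpace.single 0 1) 2 ≠ 0 ∨ fderiv ℝ (v z.1) z.2 (EuclideanSpace.single 1 1) 2 ≠ 0) ∧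
          (fderiv ℝ (v z.1) z.2 (EuclideanSpace.single 2 1) 0 ≠ 0 ∨ fderiv ℝ (v z.1) z.2 (EuclideanSpace.single 2 1) 1 ≠ 0)) →
        (∀ m : ℝ → ℝ, ∀ W₁ : Set (ℝ × EuclideanSpace ℝ (Fin 3)), W₁ ⊆ W → IsOpen W₁ → W₁.Nonempty →
          ∃ z ∈ W₁, ∃ b : Fin 3, b ≠ 2 ∧
            fderiv ℝ (v z.1) z.2 (EuclideanSpace.single 2 1) b ≠
              m z.1 * fderiv ℝ (v z.1) z.2 (EuclideanSpace.single b 1) 2) →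
        (∀ z ∈ W,
          fderiv ℝ (fun x => fderiv ℝ (v z.1) x (EuclideanSpace.single 2 1) 2) z.2 (EuclideanSpace.single 0 1) *
              fderiv ℝ (v z.1) z.2 (EuclideanSpace.single 1 1) 2 -
            fderiv ℝ (fun x => fderiv ℝ (v z.1) x (EuclideanSpace.single 2 1) 2) z.2 (EuclideanSpace.single 1 1) *
              fderiv ℝ (v z.1) z.2 (EuclideanSpace.single 0 1) 2 ≠ 0) →
        (∀ z ∈ W,
          fderiv ℝ (v z.1) z.2 (EuclideanSpace.single 2 1) 0 * fderiv ℝ (v z.1) z.2 (EuclideanSpace.single 0 1) 2 +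
            fderiv ℝ (v z.1) z.2 (EuclideanSpace.single 2 1) 1 * fderiv ℝ (v z.1) z.2 (EuclideanSpace.single 1 1) 2 < 0) →
        (∃ m : ℝ → ℝ → ℝ, ∀ z ∈ W, ∀ b : Fin 3, b ≠ 2 →
          fderiv ℝ (v z.1) z.2 (EuclideanSpace.single 2 1) b =
            m z.1 (z.2 2) * fderiv ℝ (v z.1) z.2 (EuclideanSpace.single b 1) 2) →
        ¬ Literature.Analysis.FluidPDE.IsBackwardSingularPoint v 0 := by
  sorry

/-- **STUB (H-THICK): NON-DEGENERATE + PIN + TWISTING + HYPERBOLIC window ON THE THICK STRATUM ⇒ regular (the research residue,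
re-typed).**  Verbatim the hypotheses of `stub_twisting`, PLUS: the window is HYPERBOLIC pointwise (`∂₂v₀·∂₀v₂ + ∂₂v₁·∂₁v₂ < 0`)
AND the shear ratio is a function of `(t, x₂)` on NO nonempty open subset of the window (`∇ₕΛ ≢ 0` locally — the THICK stratum,
`∂_wΛ ≠ 0` on a dense open subset since `Λ` is leafwise).  In this regime the kinematic identity
`∂₂²w + ΛΔₕw + ∂_wΛ|∇ₕw|² = 0` (tree `…StructureFunctionNormalFormTwisting.divIdentity_general`) is a GENUINELY NON-LINEAR
(`∂_wΛ ≠ 0`) quasilinear WAVE equation with the height as time, satisfied by a bounded real-analytic `w = v₂` for ALL heights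
`x₂ ∈ ℝ` in both directions: the regime of Lax–John shock formation (second derivatives obey a Riccati law along bicharacteristics
and blow up at a finite height unless the compression vanishes), to be combined with the class dynamics ((M): the (M)-free
hyperbolic witnesses of the tree all have CONSTANT ratio `Λ ≡ −1`, excluded here by the pin and by thickness). -/
theorem stub_hyperbolicThick :
    ∀ (C : ℝ) (v : ℝ → EuclideanSpace ℝ (Fin 3) → EuclideanSpace ℝ (Fin 3)),
      Literature.Analysis.FluidPDE.HasTypeITimeDecay C v →
      ContinuousOn (Function.uncurry v) (Set.Iio (0 : ℝ) ×ˢ Set.univ) →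
      (∀ s t : ℝ, s < t → t < 0 → ∀ x, v t x =
        Literature.Analysis.UnboundedOperators.heatExtension (v s) (t - s) x -
          Literature.Analysis.FluidPDE.oseenDuhamel 1 s v v t x) →
      (∀ t < 0, Literature.Analysis.FluidPDE.VectorCalculus.IsDivFree (v t)) →
      (∀ s < 0, ∀ y, ⟪Literature.Analysis.FluidPDE.curl (v s) y, EuclideanSpace.single 2 1⟫_ℝ = 0) →
      ∀ W : Set (ℝ × EuclideanSpace ℝ (Fin 3)), IsOpen W → W.Nonempty → W ⊆ Set.Iio (0 : ℝ) ×ˢ Set.univ →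
        (∀ z ∈ W, Literature.Analysis.FluidPDE.curl (v z.1) z.2 ≠ 0 ∧
          (fderiv ℝ (v z.1) z.2 (EuclideanSpace.single 0 1) 2 ≠ 0 ∨ fderiv ℝ (v z.1) z.2 (EuclideanSpace.single 1 1) 2 ≠ 0) ∧
          (fderiv ℝ (v z.1) z.2 (EuclideanSpace.single 2 1) 0 ≠ 0 ∨ fderiv ℝ (v z.1) z.2 (EuclideanSpace.single 2 1) 1 ≠ 0)) →
        (∀ m : ℝ → ℝ, ∀ W₁ : Set (ℝ × EuclideanSpace ℝ (Fin 3)), W₁ ⊆ W → IsOpen W₁ → W₁.Nonempty →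
          ∃ z ∈ W₁, ∃ b : Fin 3, b ≠ 2 ∧
            fderiv ℝ (v z.1) z.2 (EuclideanSpace.single 2 1) b ≠
              m z.1 * fderiv ℝ (v z.1) z.2 (EuclideanSpace.single b 1) 2) →
        (∀ z ∈ W,
          fderiv ℝ (fun x => fderiv ℝ (v z.1) x (EuclideanSpace.single 2 1) 2) z.2 (EuclideanSpace.single 0 1) *
              fderiv ℝ (v z.1) z.2 (EuclideanSpace.single 1 1) 2 -
            fderiv ℝ (fun x => fderiv ℝ (v z.1) x (EuclideanSpace.single 2 1) 2) z.2 (EuclideanSpace.single 1 1) *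
              fderiv ℝ (v z.1) z.2 (EuclideanSpace.single 0 1) 2 ≠ 0) →
        (∀ z ∈ W,
          fderiv ℝ (v z.1) z.2 (EuclideanSpace.single 2 1) 0 * fderiv ℝ (v z.1) z.2 (EuclideanSpace.single 0 1) 2 +
            fderiv ℝ (v z.1) z.2 (EuclideanSpace.single 2 1) 1 * fderiv ℝ (v z.1) z.2 (EuclideanSpace.single 1 1) 2 < 0) →
        (∀ m : ℝ → ℝ → ℝ, ∀ W₁ : Set (ℝ × EuclideanSpace ℝ (Fin 3)), W₁ ⊆ W → IsOpen W₁ → W₁.Nonempty →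
          ∃ z ∈ W₁, ∃ b : Fin 3, b ≠ 2 ∧
            fderiv ℝ (v z.1) z.2 (EuclideanSpace.single 2 1) b ≠
              m z.1 (z.2 2) * fderiv ℝ (v z.1) z.2 (EuclideanSpace.single b 1) 2) →
        ¬ Literature.Analysis.FluidPDE.IsBackwardSingularPoint v 0 := by
  sorry

/-! ### Pointwise: a hyperbolic point is non-degenerate -/

/-- At a point where `∂₂v₀·∂₀v₂ + ∂₂v₁·∂₁v₂ < 0` the field is non-degenerate: `curl V ≠ 0` (else `∂₂v_b = ∂_bv₂` and the scalar
is `|∇ₕv₂|² ≥ 0`), `∇ₕv₂ ≠ 0` and `∂₂vₕ ≠ 0` (else the scalar is `0`). -/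
theorem nd_of_inner_neg (V : EuclideanSpace ℝ (Fin 3) → EuclideanSpace ℝ (Fin 3)) (x : EuclideanSpace ℝ (Fin 3))
    (h : fderiv ℝ V x (EuclideanSpace.single 2 1) 0 * fderiv ℝ V x (EuclideanSpace.single 0 1) 2 +
      fderiv ℝ V x (EuclideanSpace.single 2 1) 1 * fderiv ℝ V x (EuclideanSpace.single 1 1) 2 < 0) :
    Literature.Analysis.FluidPDE.curl V x ≠ 0 ∧
      (fderiv ℝ V x (EuclideanSpace.single 0 1) 2 ≠ 0 ∨ fderiv ℝ V x (EuclideanSpace.single 1 1) 2 ≠ 0) ∧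
      (fderiv ℝ V x (EuclideanSpace.single 2 1) 0 ≠ 0 ∨ fderiv ℝ V x (EuclideanSpace.single 2 1) 1 ≠ 0) := by
  refine ⟨?_, ?_, ?_⟩
  · intro hc
    have h0 : curl V x 0 = 0 := by rw [hc]; simp
    have h1 : curl V x 1 = 0 := by rw [hc]; simp
    rw [curl_apply_zero_eq] at h0
    rw [curl_apply_one_eq] at h1
    have e1 : fderiv ℝ V x (EuclideanSpace.single 2 1) 1 = fderiv ℝ V x (EuclideanSpace.single 1 1) 2 := by linarith
    have e0 : fderiv ℝ V x (EuclideanSpace.single 2 1) 0 = fderiv ℝ V x (EuclideanSpace.single 0 1) 2 := by linarith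
    rw [e0, e1] at h
    nlinarith [sq_nonneg (fderiv ℝ V x (EuclideanSpace.single 0 1) 2), sq_nonneg (fderiv ℝ V x (EuclideanSpace.single 1 1) 2)]
  · by_contra hc
    push Not at hc
    rw [hc.1, hc.2] at h
    simp at h
  · by_contra hc
    push Not at hc
    rw [hc.1, hc.2] at h
    simp at h

/-! ### Analytic toolkit for class profiles (slices of the jointly analytic Jacobian entries) -/

section Toolkit

variable {C : ℝ} {v : ℝ → EuclideanSpace ℝ (Fin 3) → EuclideanSpace ℝ (Fin 3)}

/-- Per slice `s < 0`, the Jacobian entry `y ↦ D(v s)(y)[e_j]_i` is real-analytic on `ℝ³`. -/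
theorem entry_analyticOnNhd_slice (hrate : HasTypeITimeDecay C v)
    (hcont : ContinuousOn (uncurry v) (Iio (0 : ℝ) ×ˢ univ))
    (hmild : ∀ s t : ℝ, s < t → t < 0 → ∀ x,
      v t x = UnboundedOperators.heatExtension (v s) (t - s) x - oseenDuhamel 1 s v v t x)
    (j i : Fin 3) {s : ℝ} (hs : s < 0) :
    AnalyticOnNhd ℝ (fun y => fderiv ℝ (v s) y (EuclideanSpace.single j 1) i) univ :=
  fun y _ => analyticAt_slice_of_analyticOnNhd_uncurry
    (w := fun s y => fderiv ℝ (v s) y (EuclideanSpace.single j 1) i)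
    (analyticOnNhd_uncurry_fderiv_entry hrate hcont hmild j i) hs y

/-- The horizontal derivatives `(s,y) ↦ ∂_b(∂₂v₂)(s,y)` are jointly real-analytic on the slab. -/
theorem entry2_analyticOnNhd_uncurry (hrate : HasTypeITimeDecay C v)
    (hcont : ContinuousOn (uncurry v) (Iio (0 : ℝ) ×ˢ univ))
    (hmild : ∀ s t : ℝ, s < t → t < 0 → ∀ x,
      v t x = UnboundedOperators.heatExtension (v s) (t - s) x - oseenDuhamel 1 s v v t x) (b : Fin 3) :
    AnalyticOnNhd ℝ (uncurry fun s y =>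
      fderiv ℝ (fun x => fderiv ℝ (v s) x (EuclideanSpace.single 2 1) 2) y (EuclideanSpace.single b 1))
      (Iio (0 : ℝ) ×ˢ univ) := by
  have h22 := analyticOnNhd_uncurry_fderiv_entry hrate hcont hmild 2 2
  exact analyticOnNhd_uncurry_fderiv_slice_apply
    (w := fun s y => fderiv ℝ (v s) y (EuclideanSpace.single 2 1) 2) h22 isOpen_Iio
    (v := fun _ _ => EuclideanSpace.single b 1) analyticOnNhd_const

/-- Per slice `s < 0`, `y ↦ ∂_b(∂₂v₂)(s,y)` is real-analytic on `ℝ³`. -/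
theorem entry2_analyticOnNhd_slice (hrate : HasTypeITimeDecay C v)
    (hcont : ContinuousOn (uncurry v) (Iio (0 : ℝ) ×ˢ univ))
    (hmild : ∀ s t : ℝ, s < t → t < 0 → ∀ x,
      v t x = UnboundedOperators.heatExtension (v s) (t - s) x - oseenDuhamel 1 s v v t x)
    (b : Fin 3) {s : ℝ} (hs : s < 0) :
    AnalyticOnNhd ℝ (fun y =>
      fderiv ℝ (fun x => fderiv ℝ (v s) x (EuclideanSpace.single 2 1) 2) y (EuclideanSpace.single b 1)) univ :=
  fun y _ => analyticAt_slice_of_analyticOnNhd_uncurry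
    (w := fun t x => fderiv ℝ (fun x' => fderiv ℝ (v t) x' (EuclideanSpace.single 2 1) 2) x (EuclideanSpace.single b 1))
    (entry2_analyticOnNhd_uncurry hrate hcont hmild b) hs y

/-- Per slice `s < 0`, the TWIST BRACKET `y ↦ ∂₀(∂₂v₂)·∂₁v₂ − ∂₁(∂₂v₂)·∂₀v₂` is real-analytic on `ℝ³`. -/
theorem twist_analyticOnNhd_slice (hrate : HasTypeITimeDecay C v)
    (hcont : ContinuousOn (uncurry v) (Iio (0 : ℝ) ×ˢ univ))
    (hmild : ∀ s t : ℝ, s < t → t < 0 → ∀ x,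
      v t x = UnboundedOperators.heatExtension (v s) (t - s) x - oseenDuhamel 1 s v v t x)
    {s : ℝ} (hs : s < 0) :
    AnalyticOnNhd ℝ (fun y =>
      fderiv ℝ (fun x => fderiv ℝ (v s) x (EuclideanSpace.single 2 1) 2) y (EuclideanSpace.single 0 1) *
          fderiv ℝ (v s) y (EuclideanSpace.single 1 1) 2 -
        fderiv ℝ (fun x => fderiv ℝ (v s) x (EuclideanSpace.single 2 1) 2) y (EuclideanSpace.single 1 1) *
          fderiv ℝ (v s) y (EuclideanSpace.single 0 1) 2) univ :=
  fun y hy =>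
    (((entry2_analyticOnNhd_slice hrate hcont hmild 0 hs) y hy).fun_mul
        ((entry_analyticOnNhd_slice hrate hcont hmild 1 2 hs) y hy)).fun_sub
      (((entry2_analyticOnNhd_slice hrate hcont hmild 1 hs) y hy).fun_mul
        ((entry_analyticOnNhd_slice hrate hcont hmild 0 2 hs) y hy))

/-- Per slice `s < 0`, the TYPE SCALAR `y ↦ ∂₂v₀·∂₀v₂ + ∂₂v₁·∂₁v₂` is real-analytic on `ℝ³`. -/
theorem inner_analyticOnNhd_slice (hrate : HasTypeITimeDecay C v)
    (hcont : ContinuousOn (uncurry v) (Iio (0 : ℝ) ×ˢ univ))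
    (hmild : ∀ s t : ℝ, s < t → t < 0 → ∀ x,
      v t x = UnboundedOperators.heatExtension (v s) (t - s) x - oseenDuhamel 1 s v v t x)
    {s : ℝ} (hs : s < 0) :
    AnalyticOnNhd ℝ (fun y =>
      fderiv ℝ (v s) y (EuclideanSpace.single 2 1) 0 * fderiv ℝ (v s) y (EuclideanSpace.single 0 1) 2 +
        fderiv ℝ (v s) y (EuclideanSpace.single 2 1) 1 * fderiv ℝ (v s) y (EuclideanSpace.single 1 1) 2) univ :=
  fun y hy =>
    (((entry_analyticOnNhd_slice hrate hcont hmild 2 0 hs) y hy).fun_mul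
        ((entry_analyticOnNhd_slice hrate hcont hmild 0 2 hs) y hy)).fun_add
      (((entry_analyticOnNhd_slice hrate hcont hmild 2 1 hs) y hy).fun_mul
        ((entry_analyticOnNhd_slice hrate hcont hmild 1 2 hs) y hy))

/-- Per slice `s < 0` and any real `μ`, `y ↦ ∂₂v_b − μ ∂_bv₂` is real-analytic on `ℝ³`. -/
theorem shearDefect_analyticOnNhd_slice (hrate : HasTypeITimeDecay C v)
    (hcont : ContinuousOn (uncurry v) (Iio (0 : ℝ) ×ˢ univ))
    (hmild : ∀ s t : ℝ, s < t → t < 0 → ∀ x,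
      v t x = UnboundedOperators.heatExtension (v s) (t - s) x - oseenDuhamel 1 s v v t x)
    (μ : ℝ) (b : Fin 3) {s : ℝ} (hs : s < 0) :
    AnalyticOnNhd ℝ (fun y =>
      fderiv ℝ (v s) y (EuclideanSpace.single 2 1) b - μ * fderiv ℝ (v s) y (EuclideanSpace.single b 1) 2) univ :=
  fun y hy =>
    ((entry_analyticOnNhd_slice hrate hcont hmild 2 b hs) y hy).fun_sub
      (analyticAt_const.fun_mul ((entry_analyticOnNhd_slice hrate hcont hmild b 2 hs) y hy))

/-- The twist bracket is jointly continuous on the slab. -/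
theorem continuousOn_twist (hrate : HasTypeITimeDecay C v)
    (hcont : ContinuousOn (uncurry v) (Iio (0 : ℝ) ×ˢ univ))
    (hmild : ∀ s t : ℝ, s < t → t < 0 → ∀ x,
      v t x = UnboundedOperators.heatExtension (v s) (t - s) x - oseenDuhamel 1 s v v t x) :
    ContinuousOn (fun z : ℝ × EuclideanSpace ℝ (Fin 3) =>
      fderiv ℝ (fun x => fderiv ℝ (v z.1) x (EuclideanSpace.single 2 1) 2) z.2 (EuclideanSpace.single 0 1) *
          fderiv ℝ (v z.1) z.2 (EuclideanSpace.single 1 1) 2 -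
        fderiv ℝ (fun x => fderiv ℝ (v z.1) x (EuclideanSpace.single 2 1) 2) z.2 (EuclideanSpace.single 1 1) *
          fderiv ℝ (v z.1) z.2 (EuclideanSpace.single 0 1) 2) (Iio (0 : ℝ) ×ˢ univ) := by
  have hD : ∀ j i : Fin 3, ContinuousOn
      (fun z : ℝ × EuclideanSpace ℝ (Fin 3) => fderiv ℝ (v z.1) z.2 (EuclideanSpace.single j 1) i)
      (Iio (0 : ℝ) ×ˢ univ) := fun j i => continuousOn_fderiv_entry hrate hcont hmild j i
  have hD2 : ∀ b : Fin 3, ContinuousOn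
      (fun z : ℝ × EuclideanSpace ℝ (Fin 3) =>
        fderiv ℝ (fun x => fderiv ℝ (v z.1) x (EuclideanSpace.single 2 1) 2) z.2 (EuclideanSpace.single b 1))
      (Iio (0 : ℝ) ×ˢ univ) := fun b => (entry2_analyticOnNhd_uncurry hrate hcont hmild b).continuousOn
  exact ((hD2 0).mul (hD 1 2)).sub ((hD2 1).mul (hD 0 2))

/-- The type scalar is jointly continuous on the slab. -/
theorem continuousOn_inner (hrate : HasTypeITimeDecay C v)
    (hcont : ContinuousOn (uncurry v) (Iio (0 : ℝ) ×ˢ univ))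
    (hmild : ∀ s t : ℝ, s < t → t < 0 → ∀ x,
      v t x = UnboundedOperators.heatExtension (v s) (t - s) x - oseenDuhamel 1 s v v t x) :
    ContinuousOn (fun z : ℝ × EuclideanSpace ℝ (Fin 3) =>
      fderiv ℝ (v z.1) z.2 (EuclideanSpace.single 2 1) 0 * fderiv ℝ (v z.1) z.2 (EuclideanSpace.single 0 1) 2 +
        fderiv ℝ (v z.1) z.2 (EuclideanSpace.single 2 1) 1 * fderiv ℝ (v z.1) z.2 (EuclideanSpace.single 1 1) 2)
      (Iio (0 : ℝ) ×ˢ univ) := by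
  have hD : ∀ j i : Fin 3, ContinuousOn
      (fun z : ℝ × EuclideanSpace ℝ (Fin 3) => fderiv ℝ (v z.1) z.2 (EuclideanSpace.single j 1) i)
      (Iio (0 : ℝ) ×ˢ univ) := fun j i => continuousOn_fderiv_entry hrate hcont hmild j i
  exact ((hD 2 0).mul (hD 0 2)).add ((hD 2 1).mul (hD 1 2))

end Toolkit

/-! ### Composition, step 1: a hyperbolic twisting window is (TH) or thick (proved) -/

/-- **HYPERBOLIC TWISTING WINDOW ⇒ regular, from the two hyperbolic stubs (proved).**  Either the shear ratio is a function of
`(t, x₂)` on some nonempty open `W₁ ⊆ W` (then `W₁` inherits non-degeneracy, the pin, the twist and hyperbolicity: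
`stub_hyperbolicTH`) or on none (`stub_hyperbolicThick` on `W`). -/
theorem hyperbolic_of_stubs :
    ∀ (C : ℝ) (v : ℝ → EuclideanSpace ℝ (Fin 3) → EuclideanSpace ℝ (Fin 3)),
      Literature.Analysis.FluidPDE.HasTypeITimeDecay C v →
      ContinuousOn (Function.uncurry v) (Set.Iio (0 : ℝ) ×ˢ Set.univ) →
      (∀ s t : ℝ, s < t → t < 0 → ∀ x, v t x =
        Literature.Analysis.UnboundedOperators.heatExtension (v s) (t - s) x -
          Literature.Analysis.FluidPDE.oseenDuhamel 1 s v v t x) →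
      (∀ t < 0, Literature.Analysis.FluidPDE.VectorCalculus.IsDivFree (v t)) →
      (∀ s < 0, ∀ y, ⟪Literature.Analysis.FluidPDE.curl (v s) y, EuclideanSpace.single 2 1⟫_ℝ = 0) →
      ∀ W : Set (ℝ × EuclideanSpace ℝ (Fin 3)), IsOpen W → W.Nonempty → W ⊆ Set.Iio (0 : ℝ) ×ˢ Set.univ →
        (∀ z ∈ W, Literature.Analysis.FluidPDE.curl (v z.1) z.2 ≠ 0 ∧
          (fderiv ℝ (v z.1) z.2 (EuclideanSpace.single 0 1) 2 ≠ 0 ∨ fderiv ℝ (v z.1) z.2 (EuclideanSpace.single 1 1) 2 ≠ 0) ∧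
          (fderiv ℝ (v z.1) z.2 (EuclideanSpace.single 2 1) 0 ≠ 0 ∨ fderiv ℝ (v z.1) z.2 (EuclideanSpace.single 2 1) 1 ≠ 0)) →
        (∀ m : ℝ → ℝ, ∀ W₁ : Set (ℝ × EuclideanSpace ℝ (Fin 3)), W₁ ⊆ W → IsOpen W₁ → W₁.Nonempty →
          ∃ z ∈ W₁, ∃ b : Fin 3, b ≠ 2 ∧
            fderiv ℝ (v z.1) z.2 (EuclideanSpace.single 2 1) b ≠
              m z.1 * fderiv ℝ (v z.1) z.2 (EuclideanSpace.single b 1) 2) →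
        (∀ z ∈ W,
          fderiv ℝ (fun x => fderiv ℝ (v z.1) x (EuclideanSpace.single 2 1) 2) z.2 (EuclideanSpace.single 0 1) *
              fderiv ℝ (v z.1) z.2 (EuclideanSpace.single 1 1) 2 -
            fderiv ℝ (fun x => fderiv ℝ (v z.1) x (EuclideanSpace.single 2 1) 2) z.2 (EuclideanSpace.single 1 1) *
              fderiv ℝ (v z.1) z.2 (EuclideanSpace.single 0 1) 2 ≠ 0) →
        (∀ z ∈ W,
          fderiv ℝ (v z.1) z.2 (EuclideanSpace.single 2 1) 0 * fderiv ℝ (v z.1) z.2 (EuclideanSpace.single 0 1) 2 +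
            fderiv ℝ (v z.1) z.2 (EuclideanSpace.single 2 1) 1 * fderiv ℝ (v z.1) z.2 (EuclideanSpace.single 1 1) 2 < 0) →
        ¬ Literature.Analysis.FluidPDE.IsBackwardSingularPoint v 0 := by
  intro C v hrate hcont hmild hdiv hpol W hW hWne hWs hnd hpin htw hhyp
  by_cases hTH : ∃ m : ℝ → ℝ → ℝ, ∃ W₁ : Set (ℝ × EuclideanSpace ℝ (Fin 3)), W₁ ⊆ W ∧ IsOpen W₁ ∧ W₁.Nonempty ∧
      ∀ z ∈ W₁, ∀ b : Fin 3, b ≠ 2 →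
        fderiv ℝ (v z.1) z.2 (EuclideanSpace.single 2 1) b =
          m z.1 (z.2 2) * fderiv ℝ (v z.1) z.2 (EuclideanSpace.single b 1) 2
  · obtain ⟨m, W₁, hW₁W, hW₁, hW₁ne, hid⟩ := hTH
    exact stub_hyperbolicTH C v hrate hcont hmild hdiv hpol W₁ hW₁ hW₁ne (hW₁W.trans hWs)
      (fun z hz => hnd z (hW₁W hz)) (fun m' W₂ hW₂ hW₂o hW₂ne => hpin m' W₂ (hW₂.trans hW₁W) hW₂o hW₂ne)
      (fun z hz => htw z (hW₁W hz)) (fun z hz => hhyp z (hW₁W hz)) ⟨m, hid⟩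
  · push Not at hTH
    have hthick : ∀ m : ℝ → ℝ → ℝ, ∀ W₁ : Set (ℝ × EuclideanSpace ℝ (Fin 3)), W₁ ⊆ W → IsOpen W₁ → W₁.Nonempty →
        ∃ z ∈ W₁, ∃ b : Fin 3, b ≠ 2 ∧
          fderiv ℝ (v z.1) z.2 (EuclideanSpace.single 2 1) b ≠
            m z.1 (z.2 2) * fderiv ℝ (v z.1) z.2 (EuclideanSpace.single b 1) 2 := by
      intro m W₁ h1 h2 h3
      obtain ⟨z, hz, b, hb, hne⟩ := hTH m W₁ h1 h2 h3
      exact ⟨z, hz, b, hb, hne⟩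
    exact stub_hyperbolicThick C v hrate hcont hmild hdiv hpol W hW hWne hWs hnd hpin htw hhyp hthick

/-! ### Composition, step 2: RELOCATION — the statement of `lrc_jet`'s `stub_twisting` from the three stubs (proved) -/

/-- **NON-DEGENERATE + PIN + TWISTING ⇒ regular** — VERBATIM the statement of the registered stub `stub_twisting` of
`Lines/lrc_jet.lean` v5, PROVED from the three stubs of this skeleton by the type dichotomy with relocation: inside the product
box of `W` around a point, either some slice carries a hyperbolic point — then `{⟪∂₂vₕ,∇ₕv₂⟫ < 0} ∩ {twist ≠ 0}` in that
time-slab is a nonempty (identity theorem for the real-analytic twist bracket on the slice) open (joint continuity) hyperbolic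
twisting window, non-degenerate pointwise (`nd_of_inner_neg`) and carrying the pin (identity theorem for `∂₂v_b − m(t)∂_bv₂` on
each slice transports a local (TV) relation back to the box of `W`), so `hyperbolic_of_stubs` ends — or every slice of the box is
semi-elliptic and `stub_semiElliptic` ends on the box. -/
theorem twisting_of_mixedType :
    ∀ (C : ℝ) (v : ℝ → EuclideanSpace ℝ (Fin 3) → EuclideanSpace ℝ (Fin 3)),
      Literature.Analysis.FluidPDE.HasTypeITimeDecay C v →
      ContinuousOn (Function.uncurry v) (Set.Iio (0 : ℝ) ×ˢ Set.univ) →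
      (∀ s t : ℝ, s < t → t < 0 → ∀ x, v t x =
        Literature.Analysis.UnboundedOperators.heatExtension (v s) (t - s) x -
          Literature.Analysis.FluidPDE.oseenDuhamel 1 s v v t x) →
      (∀ t < 0, Literature.Analysis.FluidPDE.VectorCalculus.IsDivFree (v t)) →
      (∀ s < 0, ∀ y, ⟪Literature.Analysis.FluidPDE.curl (v s) y, EuclideanSpace.single 2 1⟫_ℝ = 0) →
      ∀ W : Set (ℝ × EuclideanSpace ℝ (Fin 3)), IsOpen W → W.Nonempty → W ⊆ Set.Iio (0 : ℝ) ×ˢ Set.univ →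
        (∀ z ∈ W, Literature.Analysis.FluidPDE.curl (v z.1) z.2 ≠ 0 ∧
          (fderiv ℝ (v z.1) z.2 (EuclideanSpace.single 0 1) 2 ≠ 0 ∨ fderiv ℝ (v z.1) z.2 (EuclideanSpace.single 1 1) 2 ≠ 0) ∧
          (fderiv ℝ (v z.1) z.2 (EuclideanSpace.single 2 1) 0 ≠ 0 ∨ fderiv ℝ (v z.1) z.2 (EuclideanSpace.single 2 1) 1 ≠ 0)) →
        (∀ m : ℝ → ℝ, ∀ W₁ : Set (ℝ × EuclideanSpace ℝ (Fin 3)), W₁ ⊆ W → IsOpen W₁ → W₁.Nonempty →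
          ∃ z ∈ W₁, ∃ b : Fin 3, b ≠ 2 ∧
            fderiv ℝ (v z.1) z.2 (EuclideanSpace.single 2 1) b ≠
              m z.1 * fderiv ℝ (v z.1) z.2 (EuclideanSpace.single b 1) 2) →
        (∀ z ∈ W,
          fderiv ℝ (fun x => fderiv ℝ (v z.1) x (EuclideanSpace.single 2 1) 2) z.2 (EuclideanSpace.single 0 1) *
              fderiv ℝ (v z.1) z.2 (EuclideanSpace.single 1 1) 2 -
            fderiv ℝ (fun x => fderiv ℝ (v z.1) x (EuclideanSpace.single 2 1) 2) z.2 (EuclideanSpace.single 1 1) *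
              fderiv ℝ (v z.1) z.2 (EuclideanSpace.single 0 1) 2 ≠ 0) →
        ¬ Literature.Analysis.FluidPDE.IsBackwardSingularPoint v 0 := by
  intro C v hrate hcont hmild hdiv hpol W hW hWne hWs hnd hpin htw
  -- the type scalar and the twist bracket as curried space–time functions
  set I : ℝ → EuclideanSpace ℝ (Fin 3) → ℝ := fun s y =>
    fderiv ℝ (v s) y (EuclideanSpace.single 2 1) 0 * fderiv ℝ (v s) y (EuclideanSpace.single 0 1) 2 +
      fderiv ℝ (v s) y (EuclideanSpace.single 2 1) 1 * fderiv ℝ (v s) y (EuclideanSpace.single 1 1) 2 with hI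
  set T : ℝ → EuclideanSpace ℝ (Fin 3) → ℝ := fun s y =>
    fderiv ℝ (fun x => fderiv ℝ (v s) x (EuclideanSpace.single 2 1) 2) y (EuclideanSpace.single 0 1) *
        fderiv ℝ (v s) y (EuclideanSpace.single 1 1) 2 -
      fderiv ℝ (fun x => fderiv ℝ (v s) x (EuclideanSpace.single 2 1) 2) y (EuclideanSpace.single 1 1) *
        fderiv ℝ (v s) y (EuclideanSpace.single 0 1) 2 with hT
  -- a product box around a point of `W`, inside `W` and inside the backward slab
  obtain ⟨z₀, hz₀⟩ := hWne
  have hs₀ : z₀.1 < 0 := (Set.mem_prod.1 (hWs hz₀)).1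
  obtain ⟨ε, hε, hballW⟩ := Metric.isOpen_iff.1 hW z₀ hz₀
  obtain ⟨r, hr0, hrε, hrs⟩ : ∃ r : ℝ, 0 < r ∧ r ≤ ε ∧ r ≤ -z₀.1 :=
    ⟨min ε (-z₀.1), lt_min hε (by linarith), min_le_left _ _, min_le_right _ _⟩
  have hbox : Set.Ioo (z₀.1 - r) (z₀.1 + r) ×ˢ Metric.ball z₀.2 r ⊆ W := by
    intro z hz
    apply hballW
    have h1 : z ∈ Metric.ball z₀.1 r ×ˢ Metric.ball z₀.2 r := by
      rw [Real.ball_eq_Ioo]; exact hz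
    rw [ball_prod_same] at h1
    exact Metric.ball_subset_ball hrε h1
  have hJneg : ∀ s ∈ Set.Ioo (z₀.1 - r) (z₀.1 + r), s < 0 := fun s hs => by linarith [hs.2]
  by_cases hhyp : ∃ s ∈ Set.Ioo (z₀.1 - r) (z₀.1 + r), ∃ y : EuclideanSpace ℝ (Fin 3), I s y < 0
  · -- A HYPERBOLIC POINT: relocate the twisting window to it
    obtain ⟨s, hsJ, y, hy⟩ := hhyp
    have hs : s < 0 := hJneg s hsJ
    have hsW : (s, z₀.2) ∈ W := hbox (Set.mk_mem_prod hsJ (Metric.mem_ball_self hr0))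
    have hT₀ : T s z₀.2 ≠ 0 := htw _ hsW
    -- a point of the slice `s` where the type scalar is negative AND the twist is non-zero
    obtain ⟨y₂, hIy₂, hTy₂⟩ : ∃ y₂ : EuclideanSpace ℝ (Fin 3), I s y₂ < 0 ∧ T s y₂ ≠ 0 := by
      by_contra hcon
      push Not at hcon
      have hUo : IsOpen {y' : EuclideanSpace ℝ (Fin 3) | I s y' < 0} := by
        have hc : Continuous (I s) := by
          rw [hI]
          exact (inner_analyticOnNhd_slice hrate hcont hmild hs).continuous
        exact isOpen_lt hc continuous_const
      have hTan : AnalyticOnNhd ℝ (T s) univ := by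
        rw [hT]
        exact twist_analyticOnNhd_slice hrate hcont hmild hs
      have hev : T s =ᶠ[𝓝 y] 0 := by
        filter_upwards [hUo.mem_nhds hy] with y' hy'
        exact hcon y' hy'
      have hzero := hTan.eqOn_zero_of_preconnected_of_eventuallyEq_zero isPreconnected_univ (Set.mem_univ y) hev
      exact hT₀ (hzero (Set.mem_univ z₀.2))
    -- the relocated window
    have hslab : IsOpen (Set.Iio (0 : ℝ) ×ˢ (Set.univ : Set (EuclideanSpace ℝ (Fin 3)))) :=
      isOpen_Iio.prod isOpen_univ
    have hAo : IsOpen ((Set.Iio (0 : ℝ) ×ˢ Set.univ) ∩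
        (fun z : ℝ × EuclideanSpace ℝ (Fin 3) => I z.1 z.2) ⁻¹' Set.Iio 0) := by
      have hc : ContinuousOn (fun z : ℝ × EuclideanSpace ℝ (Fin 3) => I z.1 z.2) (Set.Iio (0 : ℝ) ×ˢ Set.univ) := by
        rw [hI]
        exact continuousOn_inner hrate hcont hmild
      exact hc.isOpen_inter_preimage hslab isOpen_Iio
    have hBo : IsOpen ((Set.Iio (0 : ℝ) ×ˢ Set.univ) ∩
        (fun z : ℝ × EuclideanSpace ℝ (Fin 3) => T z.1 z.2) ⁻¹' {0}ᶜ) := by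
      have hc : ContinuousOn (fun z : ℝ × EuclideanSpace ℝ (Fin 3) => T z.1 z.2) (Set.Iio (0 : ℝ) ×ˢ Set.univ) := by
        rw [hT]
        exact continuousOn_twist hrate hcont hmild
      exact hc.isOpen_inter_preimage hslab isOpen_compl_singleton
    set W' : Set (ℝ × EuclideanSpace ℝ (Fin 3)) :=
      (Set.Ioo (z₀.1 - r) (z₀.1 + r) ×ˢ Set.univ) ∩
        (((Set.Iio (0 : ℝ) ×ˢ Set.univ) ∩ (fun z : ℝ × EuclideanSpace ℝ (Fin 3) => I z.1 z.2) ⁻¹' Set.Iio 0) ∩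
         ((Set.Iio (0 : ℝ) ×ˢ Set.univ) ∩ (fun z : ℝ × EuclideanSpace ℝ (Fin 3) => T z.1 z.2) ⁻¹' {0}ᶜ)) with hW'
    have hW'o : IsOpen W' := (isOpen_Ioo.prod isOpen_univ).inter (hAo.inter hBo)
    have hW'ne : W'.Nonempty :=
      ⟨(s, y₂), Set.mk_mem_prod hsJ (Set.mem_univ _),
        ⟨Set.mk_mem_prod hs (Set.mem_univ _), hIy₂⟩, ⟨Set.mk_mem_prod hs (Set.mem_univ _), hTy₂⟩⟩
    have hW's : W' ⊆ Set.Iio (0 : ℝ) ×ˢ Set.univ := fun z hz => hz.2.1.1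
    have hW'J : ∀ z ∈ W', z.1 ∈ Set.Ioo (z₀.1 - r) (z₀.1 + r) := fun z hz => (Set.mem_prod.1 hz.1).1
    have hW'I : ∀ z ∈ W', I z.1 z.2 < 0 := fun z hz => hz.2.1.2
    have hW'T : ∀ z ∈ W', T z.1 z.2 ≠ 0 := fun z hz => hz.2.2.2
    have hW'nd : ∀ z ∈ W', Literature.Analysis.FluidPDE.curl (v z.1) z.2 ≠ 0 ∧
        (fderiv ℝ (v z.1) z.2 (EuclideanSpace.single 0 1) 2 ≠ 0 ∨ fderiv ℝ (v z.1) z.2 (EuclideanSpace.single 1 1) 2 ≠ 0) ∧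
        (fderiv ℝ (v z.1) z.2 (EuclideanSpace.single 2 1) 0 ≠ 0 ∨ fderiv ℝ (v z.1) z.2 (EuclideanSpace.single 2 1) 1 ≠ 0) :=
      fun z hz => nd_of_inner_neg (v z.1) z.2 (hW'I z hz)
    -- the pin transfers to the relocated window (identity theorem on each slice)
    have hW'pin : ∀ m : ℝ → ℝ, ∀ W₁ : Set (ℝ × EuclideanSpace ℝ (Fin 3)), W₁ ⊆ W' → IsOpen W₁ → W₁.Nonempty →
        ∃ z ∈ W₁, ∃ b : Fin 3, b ≠ 2 ∧
          fderiv ℝ (v z.1) z.2 (EuclideanSpace.single 2 1) b ≠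
            m z.1 * fderiv ℝ (v z.1) z.2 (EuclideanSpace.single b 1) 2 := by
      intro m W₁ hW₁ hW₁o hW₁ne
      by_contra hcon
      push Not at hcon
      obtain ⟨z₁, hz₁⟩ := hW₁ne
      obtain ⟨ρ, hρ, hballρ⟩ := Metric.isOpen_iff.1 hW₁o z₁ hz₁
      have hz₁J : z₁.1 ∈ Set.Ioo (z₀.1 - r) (z₀.1 + r) := hW'J z₁ (hW₁ hz₁)
      set W₂ : Set (ℝ × EuclideanSpace ℝ (Fin 3)) :=
        (Metric.ball z₁.1 ρ ∩ Set.Ioo (z₀.1 - r) (z₀.1 + r)) ×ˢ Metric.ball z₀.2 r with hW₂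
      have hW₂W : W₂ ⊆ W := fun z hz =>
        hbox (Set.mem_prod.2 ⟨(Set.mem_prod.1 hz).1.2, (Set.mem_prod.1 hz).2⟩)
      have hW₂o : IsOpen W₂ := (Metric.isOpen_ball.inter isOpen_Ioo).prod Metric.isOpen_ball
      have hW₂ne : W₂.Nonempty :=
        ⟨(z₁.1, z₀.2), Set.mk_mem_prod ⟨Metric.mem_ball_self hρ, hz₁J⟩ (Metric.mem_ball_self hr0)⟩
      obtain ⟨z, hzW₂, b, hb, hne⟩ := hpin m W₂ hW₂W hW₂o hW₂ne
      have hzt : z.1 ∈ Metric.ball z₁.1 ρ := (Set.mem_prod.1 hzW₂).1.1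
      have hzneg : z.1 < 0 := hJneg _ (Set.mem_prod.1 hzW₂).1.2
      -- the (TV) relation holds on the slice `z.1` near `z₁.2` …
      have hrel : ∀ y' ∈ Metric.ball z₁.2 ρ,
          fderiv ℝ (v z.1) y' (EuclideanSpace.single 2 1) b = m z.1 * fderiv ℝ (v z.1) y' (EuclideanSpace.single b 1) 2 := by
        intro y' hy'
        have hmem' : (z.1, y') ∈ Metric.ball z₁.1 ρ ×ˢ Metric.ball z₁.2 ρ := Set.mk_mem_prod hzt hy'
        rw [ball_prod_same] at hmem'
        exact hcon _ (hballρ hmem') b hb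
      -- … hence everywhere on that slice (identity theorem), in particular at `z.2`
      have han := shearDefect_analyticOnNhd_slice hrate hcont hmild (m z.1) b hzneg
      have hev : (fun y' => fderiv ℝ (v z.1) y' (EuclideanSpace.single 2 1) b -
          m z.1 * fderiv ℝ (v z.1) y' (EuclideanSpace.single b 1) 2) =ᶠ[𝓝 z₁.2] 0 := by
        filter_upwards [Metric.isOpen_ball.mem_nhds (Metric.mem_ball_self hρ)] with y' hy'
        show _ - _ = (0 : ℝ)
        rw [hrel y' hy', sub_self]
      have hzero := han.eqOn_zero_of_preconnected_of_eventuallyEq_zero isPreconnected_univ (Set.mem_univ z₁.2) hev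
      have h0 : fderiv ℝ (v z.1) z.2 (EuclideanSpace.single 2 1) b -
          m z.1 * fderiv ℝ (v z.1) z.2 (EuclideanSpace.single b 1) 2 = 0 := hzero (Set.mem_univ z.2)
      exact hne (sub_eq_zero.1 h0)
    exact hyperbolic_of_stubs C v hrate hcont hmild hdiv hpol W' hW'o hW'ne hW's hW'nd hW'pin hW'T hW'I
  · -- NO HYPERBOLIC POINT IN THE SLAB: every slice of the box is semi-elliptic
    push Not at hhyp
    set W₀ : Set (ℝ × EuclideanSpace ℝ (Fin 3)) := Set.Ioo (z₀.1 - r) (z₀.1 + r) ×ˢ Metric.ball z₀.2 r with hW₀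
    have hW₀W : W₀ ⊆ W := hbox
    have hz₀W₀ : z₀ ∈ W₀ :=
      Set.mem_prod.2 ⟨⟨by linarith, by linarith⟩, Metric.mem_ball_self hr0⟩
    exact stub_semiElliptic C v hrate hcont hmild hdiv hpol W₀ (isOpen_Ioo.prod Metric.isOpen_ball) ⟨z₀, hz₀W₀⟩
      (hW₀W.trans hWs) (fun z hz => hnd z (hW₀W hz))
      (fun m W₁ hW₁ hW₁o hW₁ne => hpin m W₁ (hW₁.trans hW₀W) hW₁o hW₁ne) (fun z hz => htw z (hW₀W hz))
      (z₀.1 - r) (z₀.1 + r) (Set.prod_mono le_rfl (Set.subset_univ _)) hhyp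

/-! ### Composition, step 3: the crux (exactly as in `lrc_jet` v5, with `twisting_of_mixedType` for `stub_twisting`) -/

/-- **NON-DEGENERATE + PIN ⇒ regular** — the pointwise twist dichotomy over the tree theorem `…StubUntwisted.stub_untwisted`
(p561151, the untwisted half) and `twisting_of_mixedType` (the twisting half, from the three stubs). -/
theorem ndRegular :
    ∀ (C : ℝ) (v : ℝ → EuclideanSpace ℝ (Fin 3) → EuclideanSpace ℝ (Fin 3)),
      Literature.Analysis.FluidPDE.HasTypeITimeDecay C v →
      ContinuousOn (Function.uncurry v) (Set.Iio (0 : ℝ) ×ˢ Set.univ) →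
      (∀ s t : ℝ, s < t → t < 0 → ∀ x, v t x =
        Literature.Analysis.UnboundedOperators.heatExtension (v s) (t - s) x -
          Literature.Analysis.FluidPDE.oseenDuhamel 1 s v v t x) →
      (∀ t < 0, Literature.Analysis.FluidPDE.VectorCalculus.IsDivFree (v t)) →
      (∀ s < 0, ∀ y, ⟪Literature.Analysis.FluidPDE.curl (v s) y, EuclideanSpace.single 2 1⟫_ℝ = 0) →
      ∀ W : Set (ℝ × EuclideanSpace ℝ (Fin 3)), IsOpen W → W.Nonempty → W ⊆ Set.Iio (0 : ℝ) ×ˢ Set.univ →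
        (∀ z ∈ W, Literature.Analysis.FluidPDE.curl (v z.1) z.2 ≠ 0 ∧
          (fderiv ℝ (v z.1) z.2 (EuclideanSpace.single 0 1) 2 ≠ 0 ∨ fderiv ℝ (v z.1) z.2 (EuclideanSpace.single 1 1) 2 ≠ 0) ∧
          (fderiv ℝ (v z.1) z.2 (EuclideanSpace.single 2 1) 0 ≠ 0 ∨ fderiv ℝ (v z.1) z.2 (EuclideanSpace.single 2 1) 1 ≠ 0)) →
        (∀ m : ℝ → ℝ, ∀ W₁ : Set (ℝ × EuclideanSpace ℝ (Fin 3)), W₁ ⊆ W → IsOpen W₁ → W₁.Nonempty →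
          ∃ z ∈ W₁, ∃ b : Fin 3, b ≠ 2 ∧
            fderiv ℝ (v z.1) z.2 (EuclideanSpace.single 2 1) b ≠
              m z.1 * fderiv ℝ (v z.1) z.2 (EuclideanSpace.single b 1) 2) →
        ¬ Literature.Analysis.FluidPDE.IsBackwardSingularPoint v 0 := by
  intro C v hrate hcont hmild hdiv hpol W hW hWne hWs hnd hpin
  set T : ℝ × EuclideanSpace ℝ (Fin 3) → ℝ := fun z =>
    fderiv ℝ (fun x => fderiv ℝ (v z.1) x (EuclideanSpace.single 2 1) 2) z.2 (EuclideanSpace.single 0 1) *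
              fderiv ℝ (v z.1) z.2 (EuclideanSpace.single 1 1) 2 -
            fderiv ℝ (fun x => fderiv ℝ (v z.1) x (EuclideanSpace.single 2 1) 2) z.2 (EuclideanSpace.single 1 1) *
              fderiv ℝ (v z.1) z.2 (EuclideanSpace.single 0 1) 2 with hT
  by_cases htw : ∃ z ∈ W, T z ≠ 0
  · obtain ⟨z₀, hz₀W, hz₀⟩ := htw
    have hslab : IsOpen (Set.Iio (0 : ℝ) ×ˢ (Set.univ : Set (EuclideanSpace ℝ (Fin 3)))) :=
      isOpen_Iio.prod isOpen_univ
    have hTc : ContinuousOn T (Set.Iio (0 : ℝ) ×ˢ Set.univ) := by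
      rw [hT]
      exact continuousOn_twist hrate hcont hmild
    have hO : IsOpen ((Set.Iio (0 : ℝ) ×ˢ Set.univ) ∩ T ⁻¹' {0}ᶜ) :=
      hTc.isOpen_inter_preimage hslab isOpen_compl_singleton
    set W₃ : Set (ℝ × EuclideanSpace ℝ (Fin 3)) := W ∩ ((Set.Iio (0 : ℝ) ×ˢ Set.univ) ∩ T ⁻¹' {0}ᶜ) with hW₃
    have hW₃o : IsOpen W₃ := hW.inter hO
    have hW₃W : W₃ ⊆ W := Set.inter_subset_left
    have hW₃ne : W₃.Nonempty := ⟨z₀, hz₀W, hWs hz₀W, hz₀⟩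
    refine twisting_of_mixedType C v hrate hcont hmild hdiv hpol W₃ hW₃o hW₃ne (hW₃W.trans hWs)
      (fun z hz => hnd z (hW₃W hz)) (fun m W₁ hW₁ hW₁o hW₁ne => hpin m W₁ (hW₁.trans hW₃W) hW₁o hW₁ne) ?_
    intro z hz
    exact hz.2.2
  · push Not at htw
    exact Summit.NavierStokesRegularity.NavierStokesRegularity.Theorems.PoloidalWindowDoorPoloidalWindowRigidityStubUntwisted.stub_untwisted
      C v hrate hcont hmild hdiv hpol W hW hWne hWs hnd htw

/-- **LRC″ with spatial pins, UNDER THE SINGULARITY ASSUMPTION** (vacuously, from `ndRegular`) — the hypothesis `hLRC` of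
`…K2OfLrcSpatial.nonflatLiouville_of_lrc_spatial`. -/
theorem lrcSpatial_of_stubs :
    ∀ (C : ℝ) (v : ℝ → EuclideanSpace ℝ (Fin 3) → EuclideanSpace ℝ (Fin 3)),
      Literature.Analysis.FluidPDE.HasTypeITimeDecay C v →
      ContinuousOn (Function.uncurry v) (Set.Iio (0 : ℝ) ×ˢ Set.univ) →
      (∀ s t : ℝ, s < t → t < 0 → ∀ x, v t x =
        Literature.Analysis.UnboundedOperators.heatExtension (v s) (t - s) x -
          Literature.Analysis.FluidPDE.oseenDuhamel 1 s v v t x) →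
      (∀ t < 0, Literature.Analysis.FluidPDE.VectorCalculus.IsDivFree (v t)) →
      (∀ s < 0, ∀ y, ⟪Literature.Analysis.FluidPDE.curl (v s) y, EuclideanSpace.single 2 1⟫_ℝ = 0) →
      Literature.Analysis.FluidPDE.IsBackwardSingularPoint v 0 →
      ∀ W : Set (ℝ × EuclideanSpace ℝ (Fin 3)), IsOpen W → W.Nonempty → W ⊆ Set.Iio (0 : ℝ) ×ˢ Set.univ →
        (∀ z ∈ W, Literature.Analysis.FluidPDE.curl (v z.1) z.2 ≠ 0 ∧
          (fderiv ℝ (v z.1) z.2 (EuclideanSpace.single 0 1) 2 ≠ 0 ∨ fderiv ℝ (v z.1) z.2 (EuclideanSpace.single 1 1) 2 ≠ 0) ∧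
          (fderiv ℝ (v z.1) z.2 (EuclideanSpace.single 2 1) 0 ≠ 0 ∨ fderiv ℝ (v z.1) z.2 (EuclideanSpace.single 2 1) 1 ≠ 0)) →
        (∀ m : ℝ → ℝ, ∀ W₁ : Set (ℝ × EuclideanSpace ℝ (Fin 3)), W₁ ⊆ W → IsOpen W₁ → W₁.Nonempty →
          ∃ z ∈ W₁, ∃ b : Fin 3, b ≠ 2 ∧
            fderiv ℝ (v z.1) z.2 (EuclideanSpace.single 2 1) b ≠
              m z.1 * fderiv ℝ (v z.1) z.2 (EuclideanSpace.single b 1) 2) →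
        ∃ s : ℝ, s < 0 ∧ ∃ U : Set (EuclideanSpace ℝ (Fin 3)), IsOpen U ∧ U.Nonempty ∧
          ((∃ e : EuclideanSpace ℝ (Fin 3), e ≠ 0 ∧ ∀ y ∈ U, fderiv ℝ (Literature.Analysis.FluidPDE.curl (v s)) y e = 0) ∨
           (∃ c : EuclideanSpace ℝ (Fin 3), ∀ y ∈ U,
              Literature.Analysis.FluidPDE.rotGen (Literature.Analysis.FluidPDE.curl (v s) y) =
                fderiv ℝ (Literature.Analysis.FluidPDE.curl (v s)) y (Literature.Analysis.FluidPDE.rotGen (y - c)))) := by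
  intro C v hrate hcont hmild hdiv hpol hsing W hW hWne hWs hnd hpin
  exact absurd hsing (ndRegular C v hrate hcont hmild hdiv hpol W hW hWne hWs hnd hpin)

/-- **(TV) — both halves are tree theorems** (`…TimeShearLiminf.stub_tvLiminf`, p525351, and
`…HorizontalFlatPast.nonflatLiouville_of_timeShear_unbounded`): the hypothesis `hTV` of
`…K2OfLrcSpatial.nonflatLiouville_of_lrc_spatial`. -/
theorem tv_of_stubs :
    ∀ (C : ℝ) (v : ℝ → EuclideanSpace ℝ (Fin 3) → EuclideanSpace ℝ (Fin 3)),
      Literature.Analysis.FluidPDE.HasTypeITimeDecay C v →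
      ContinuousOn (Function.uncurry v) (Set.Iio (0 : ℝ) ×ˢ Set.univ) →
      (∀ s t : ℝ, s < t → t < 0 → ∀ x, v t x =
        Literature.Analysis.UnboundedOperators.heatExtension (v s) (t - s) x -
          Literature.Analysis.FluidPDE.oseenDuhamel 1 s v v t x) →
      (∀ t < 0, Literature.Analysis.FluidPDE.VectorCalculus.IsDivFree (v t)) →
      (∀ s < 0, ∀ y, ⟪Literature.Analysis.FluidPDE.curl (v s) y, EuclideanSpace.single 2 1⟫_ℝ = 0) →
      ∀ μ : ℝ → ℝ, (∀ s < 0, μ s < 0) → (∀ s < 0, AnalyticAt ℝ μ s) →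
        (∃ s₁ s₂ : ℝ, s₁ < 0 ∧ s₂ < 0 ∧ μ s₁ ≠ μ s₂) →
        (∀ s < 0, ∀ y, ∀ b : Fin 3, b ≠ 2 →
          fderiv ℝ (v s) y (EuclideanSpace.single 2 1) b = μ s * fderiv ℝ (v s) y (EuclideanSpace.single b 1) 2) →
        ¬ Literature.Analysis.FluidPDE.IsBackwardSingularPoint v 0 := by
  intro C v hrate hcont hmild hdiv hpol μ hneg han hnc hslope
  by_cases hB : ∃ M : ℝ, ∀ T : ℝ, ∃ τ < T, -M ≤ μ τ
  · exact Summit.NavierStokesRegularity.NavierStokesRegularity.Theorems.PoloidalWindowDoorPoloidalWindowRigidityTimeShearLiminf.stub_tvLiminf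
      C v hrate hcont hmild hdiv hpol μ hneg han hnc hslope hB
  · push Not at hB
    refine nonflatLiouville_of_timeShear_unbounded hrate hcont hmild hdiv hpol hslope fun M => ?_
    obtain ⟨T, hT⟩ := hB M
    refine ⟨T, fun τ hτ => ?_⟩
    have h1 : μ τ < -M := hT τ hτ
    have h2 : M < -μ τ := by linarith
    exact h2.le.trans (neg_le_abs (μ τ))

/-- **The slice-sharp residue from the stubs** (symmetry/genericity hypotheses unused): class + poloidal ⇒ not backward-singular,
by contradiction through `…K2OfLrcSpatial.nonflatLiouville_of_lrc_spatial`. -/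
theorem sliceSharpNonflatLiouville_of_mixedType :
    ∀ (C : ℝ) (v : ℝ → EuclideanSpace ℝ (Fin 3) → EuclideanSpace ℝ (Fin 3)),
      Literature.Analysis.FluidPDE.HasTypeITimeDecay C v →
      ContinuousOn (Function.uncurry v) (Set.Iio (0 : ℝ) ×ˢ Set.univ) →
      (∀ s t : ℝ, s < t → t < 0 → ∀ x, v t x =
        Literature.Analysis.UnboundedOperators.heatExtension (v s) (t - s) x -
          Literature.Analysis.FluidPDE.oseenDuhamel 1 s v v t x) →
      (∀ t < 0, Literature.Analysis.FluidPDE.VectorCalculus.IsDivFree (v t)) →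
      (∀ s < 0, ∀ y, ⟪Literature.Analysis.FluidPDE.curl (v s) y, EuclideanSpace.single 2 1⟫_ℝ = 0) →
      (∀ s < 0, ∀ y, ⟪fderiv ℝ (v s) y (Literature.Analysis.FluidPDE.curl (v s) y), EuclideanSpace.single 2 1⟫_ℝ = 0) →
      (∀ s < 0, ∀ b : EuclideanSpace ℝ (Fin 3), b ≠ 0 → ∃ y,
        Literature.Analysis.FluidPDE.cross (Literature.Analysis.FluidPDE.curl (v s) y) b ≠ 0) →
      (∀ s < 0, ∃ y, fderiv ℝ (v s) y (EuclideanSpace.single 2 1) 0 ≠ 0 ∨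
        fderiv ℝ (v s) y (EuclideanSpace.single 2 1) 1 ≠ 0) →
      (∀ s < 0, ∀ a : EuclideanSpace ℝ (Fin 3), a ≠ 0 → ⟪a, EuclideanSpace.single 2 1⟫_ℝ = 0 →
        ∃ y, ⟪fderiv ℝ (v s) y a, EuclideanSpace.single 2 1⟫_ℝ ≠ 0) →
      (∀ s < 0, ∀ e : EuclideanSpace ℝ (Fin 3), e ≠ 0 → ∃ (y : EuclideanSpace ℝ (Fin 3)) (l : ℝ), v s (y + l • e) ≠ v s y) →
      (∀ s < 0, ∀ (L : EuclideanSpace ℝ (Fin 3) ≃ₗᵢ[ℝ] EuclideanSpace ℝ (Fin 3)) (c : EuclideanSpace ℝ (Fin 3)),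
        ¬ Literature.Analysis.FluidPDE.IsAxisymmetric (fun y => L.symm (v s (L y + c)))) →
      (∃ lam : ℝ, 0 < lam ∧ ∃ s < 0, ∃ y, lam • v (lam ^ 2 * s) (lam • y) ≠ v s y) →
      ¬ Literature.Analysis.FluidPDE.IsBackwardSingularPoint v 0 := by
  intro C v hrate hcont hmild hdiv hpol _ _ _ _ _ _ _ hsing
  exact nonflatLiouville_of_lrc_spatial hrate hcont hmild hdiv hpol
    (lrcSpatial_of_stubs C v hrate hcont hmild hdiv hpol hsing) (tv_of_stubs C v hrate hcont hmild hdiv hpol) hsing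

/-- **COMPOSITION (proved): the crux `PoloidalWindowRigidity` from the three stubs `stub_semiElliptic`, `stub_hyperbolicTH`,
`stub_hyperbolicThick`**, via the landed reduction `…Sharper.poloidalWindowRigidity_of_sliceSharpNonflatLiouville`. -/
theorem PoloidalWindowRigidity_of_mixedType :
    Summit.NavierStokesRegularity.NavierStokesRegularity.Theses.PoloidalWindowDoor.PoloidalWindowRigidity :=
  poloidalWindowRigidity_of_sliceSharpNonflatLiouville sliceSharpNonflatLiouville_of_mixedType

/-! ### v2: the by-name closers — two velocity-only LOCAL certificates close all three stubs -/

open scoped Laplacian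

/-- **`hempty_thick ⇒ stub_semiEllipticThick`** (proved; same mechanism as K2-p4's `…ThickStubsOfLocalEmpty.stub_hyperbolicThick_of_localEmptyThick`):
a class profile is a local poloidal NS germ on the window, `hempty_thick` yields a time–height sub-window
(`exists_timeHeight_subwindow_of_localEmptyThick`), contradicting the thickness clause; the semi-elliptic sign is not used. -/
theorem stub_semiEllipticThick_of_localEmptyThick (hempty_thick : ∀ (u : ℝ → EuclideanSpace ℝ (Fin 3) → EuclideanSpace ℝ (Fin 3))
      (U : Set (ℝ × EuclideanSpace ℝ (Fin 3))) (p₀ : ℝ × EuclideanSpace ℝ (Fin 3)),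
      IsOpen U → p₀ ∈ U →
      AnalyticOnNhd ℝ (Function.uncurry u) U →
      (∀ p ∈ U, fderiv ℝ (u p.1) p.2 (EuclideanSpace.single 0 1) 0 + fderiv ℝ (u p.1) p.2 (EuclideanSpace.single 1 1) 1 +
        fderiv ℝ (u p.1) p.2 (EuclideanSpace.single 2 1) 2 = 0) →
      (∀ p ∈ U, fderiv ℝ (u p.1) p.2 (EuclideanSpace.single 0 1) 1 = fderiv ℝ (u p.1) p.2 (EuclideanSpace.single 1 1) 0) →
      (∀ p ∈ U, fderiv ℝ (u p.1) p.2 (EuclideanSpace.single 2 1) 0 * fderiv ℝ (u p.1) p.2 (EuclideanSpace.single 1 1) 2 -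
        fderiv ℝ (u p.1) p.2 (EuclideanSpace.single 2 1) 1 * fderiv ℝ (u p.1) p.2 (EuclideanSpace.single 0 1) 2 = 0) →
      (∀ p ∈ U, ∀ j k : Fin 3,
        fderiv ℝ (fun y => deriv (fun s => u s y k) p.1 + fderiv ℝ (fun y' => u p.1 y' k) y (u p.1 y) -
            (Δ (fun y' => u p.1 y' k)) y) p.2 (EuclideanSpace.single j 1) =
          fderiv ℝ (fun y => deriv (fun s => u s y j) p.1 + fderiv ℝ (fun y' => u p.1 y' j) y (u p.1 y) -
            (Δ (fun y' => u p.1 y' j)) y) p.2 (EuclideanSpace.single k 1)) →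
      fderiv ℝ (fun y => fderiv ℝ (u p₀.1) y (EuclideanSpace.single 2 1) 2) p₀.2 (EuclideanSpace.single 0 1) *
            fderiv ℝ (u p₀.1) p₀.2 (EuclideanSpace.single 1 1) 2 -
          fderiv ℝ (fun y => fderiv ℝ (u p₀.1) y (EuclideanSpace.single 2 1) 2) p₀.2 (EuclideanSpace.single 1 1) *
            fderiv ℝ (u p₀.1) p₀.2 (EuclideanSpace.single 0 1) 2 ≠ 0 →
      (fderiv ℝ (u p₀.1) p₀.2 (EuclideanSpace.single 0 1) 2 ≠ 0 ∨ fderiv ℝ (u p₀.1) p₀.2 (EuclideanSpace.single 1 1) 2 ≠ 0) →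
      (fderiv ℝ (u p₀.1) p₀.2 (EuclideanSpace.single 2 1) 0 ≠ 0 ∨ fderiv ℝ (u p₀.1) p₀.2 (EuclideanSpace.single 2 1) 1 ≠ 0) →
      Literature.Analysis.FluidPDE.curl (u p₀.1) p₀.2 ≠ 0 →
      (fderiv ℝ (fun y =>
            (fderiv ℝ (u p₀.1) y (EuclideanSpace.single 2 1) 0 * fderiv ℝ (u p₀.1) y (EuclideanSpace.single 0 1) 2 +
                fderiv ℝ (u p₀.1) y (EuclideanSpace.single 2 1) 1 * fderiv ℝ (u p₀.1) y (EuclideanSpace.single 1 1) 2) /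
              (fderiv ℝ (u p₀.1) y (EuclideanSpace.single 0 1) 2 ^ 2 + fderiv ℝ (u p₀.1) y (EuclideanSpace.single 1 1) 2 ^ 2))
            p₀.2 (EuclideanSpace.single 0 1) ≠ 0 ∨
        fderiv ℝ (fun y =>
            (fderiv ℝ (u p₀.1) y (EuclideanSpace.single 2 1) 0 * fderiv ℝ (u p₀.1) y (EuclideanSpace.single 0 1) 2 +
                fderiv ℝ (u p₀.1) y (EuclideanSpace.single 2 1) 1 * fderiv ℝ (u p₀.1) y (EuclideanSpace.single 1 1) 2) /
              (fderiv ℝ (u p₀.1) y (EuclideanSpace.single 0 1) 2 ^ 2 + fderiv ℝ (u p₀.1) y (EuclideanSpace.single 1 1) 2 ^ 2))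
            p₀.2 (EuclideanSpace.single 1 1) ≠ 0) →
      False) :
    ∀ (C : ℝ) (v : ℝ → EuclideanSpace ℝ (Fin 3) → EuclideanSpace ℝ (Fin 3)),
      Literature.Analysis.FluidPDE.HasTypeITimeDecay C v →
      ContinuousOn (Function.uncurry v) (Set.Iio (0 : ℝ) ×ˢ Set.univ) →
      (∀ s t : ℝ, s < t → t < 0 → ∀ x, v t x =
        Literature.Analysis.UnboundedOperators.heatExtension (v s) (t - s) x -
          Literature.Analysis.FluidPDE.oseenDuhamel 1 s v v t x) →
      (∀ t < 0, Literature.Analysis.FluidPDE.VectorCalculus.IsDivFree (v t)) →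
      (∀ s < 0, ∀ y, ⟪Literature.Analysis.FluidPDE.curl (v s) y, EuclideanSpace.single 2 1⟫_ℝ = 0) →
      ∀ W : Set (ℝ × EuclideanSpace ℝ (Fin 3)), IsOpen W → W.Nonempty → W ⊆ Set.Iio (0 : ℝ) ×ˢ Set.univ →
        (∀ z ∈ W, Literature.Analysis.FluidPDE.curl (v z.1) z.2 ≠ 0 ∧
          (fderiv ℝ (v z.1) z.2 (EuclideanSpace.single 0 1) 2 ≠ 0 ∨ fderiv ℝ (v z.1) z.2 (EuclideanSpace.single 1 1) 2 ≠ 0) ∧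
          (fderiv ℝ (v z.1) z.2 (EuclideanSpace.single 2 1) 0 ≠ 0 ∨ fderiv ℝ (v z.1) z.2 (EuclideanSpace.single 2 1) 1 ≠ 0)) →
        (∀ m : ℝ → ℝ, ∀ W₁ : Set (ℝ × EuclideanSpace ℝ (Fin 3)), W₁ ⊆ W → IsOpen W₁ → W₁.Nonempty →
          ∃ z ∈ W₁, ∃ b : Fin 3, b ≠ 2 ∧
            fderiv ℝ (v z.1) z.2 (EuclideanSpace.single 2 1) b ≠
              m z.1 * fderiv ℝ (v z.1) z.2 (EuclideanSpace.single b 1) 2) →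
        (∀ z ∈ W,
          fderiv ℝ (fun x => fderiv ℝ (v z.1) x (EuclideanSpace.single 2 1) 2) z.2 (EuclideanSpace.single 0 1) *
              fderiv ℝ (v z.1) z.2 (EuclideanSpace.single 1 1) 2 -
            fderiv ℝ (fun x => fderiv ℝ (v z.1) x (EuclideanSpace.single 2 1) 2) z.2 (EuclideanSpace.single 1 1) *
              fderiv ℝ (v z.1) z.2 (EuclideanSpace.single 0 1) 2 ≠ 0) →
        ∀ a b : ℝ, W ⊆ Set.Ioo a b ×ˢ Set.univ →
          (∀ s ∈ Set.Ioo a b, ∀ y : EuclideanSpace ℝ (Fin 3),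
            0 ≤ fderiv ℝ (v s) y (EuclideanSpace.single 2 1) 0 * fderiv ℝ (v s) y (EuclideanSpace.single 0 1) 2 +
              fderiv ℝ (v s) y (EuclideanSpace.single 2 1) 1 * fderiv ℝ (v s) y (EuclideanSpace.single 1 1) 2) →
        (∀ m : ℝ → ℝ → ℝ, ∀ W₁ : Set (ℝ × EuclideanSpace ℝ (Fin 3)), W₁ ⊆ W → IsOpen W₁ → W₁.Nonempty →
          ∃ z ∈ W₁, ∃ b : Fin 3, b ≠ 2 ∧
            fderiv ℝ (v z.1) z.2 (EuclideanSpace.single 2 1) b ≠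
              m z.1 (z.2 2) * fderiv ℝ (v z.1) z.2 (EuclideanSpace.single b 1) 2) →
        ¬ Literature.Analysis.FluidPDE.IsBackwardSingularPoint v 0 := by
  intro C v hrate hcont hmild hdiv hpol W hW hWne hWs hnd _ htw _ _ _ _ hthick
  obtain ⟨U₁, hU₁W, hU₁o, hU₁ne, m, hm⟩ :=
    Summit.NavierStokesRegularity.NavierStokesRegularity.Theorems.PoloidalWindowDoorPoloidalWindowRigidityThickStubsOfLocalEmpty.exists_timeHeight_subwindow_of_localEmptyThick
      hempty_thick hrate hcont hmild hdiv hpol hW hWne hWs hnd htw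
  obtain ⟨z, hz, b, hb, hne⟩ := hthick m U₁ hU₁W hU₁o hU₁ne
  exact absurd (hm z hz b hb) hne

end Summit.NavierStokesRegularity.NavierStokesRegularity.Cruxes.PoloidalWindowRigidity.MixedType
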